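import Summits.BirchSwinnertonDyer.BirchSwinnertonDyer.Theorems.Rank1ResidualX9SmallImageKolyvagin
import Summits.BirchSwinnertonDyer.BirchSwinnertonDyer.Theorems.Rank1ResidualX9TwistedImGL2Five
import Summits.BirchSwinnertonDyer.BirchSwinnertonDyer.Theorems.Rank1ResidualX9TwistedImLift
import Summits.BirchSwinnertonDyer.BirchSwinnertonDyer.Theorems.Rank1ResidualX9TwistedImIdempotent
import Literature.NumberTheory.EllipticCurves.Rank1Residual.X9ImageShape
import Literature.NumberTheory.EllipticCurves.TateModuleFinrankProofs
import Literature.NumberTheory.EllipticCurves.TateModuleProjSurjectiveProofs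
import Literature.NumberTheory.EllipticCurves.KrizLi2019.TeichmullerCharacterExists
import HarnessLib

/-!
# Class X9: the twisted hypothesis (im) HOLDS — kernel proof of `X9TwistedHypothesisIm`

HONEST FRAMING (cell `b2b-bsdres`, X9 prover lineage; the node was typed by cell `bsd-smallim`,
seat `koly`, in `Theorems/Rank1ResidualX9SmallImageKolyvagin`): this file PROVES, in the kernel,
the obligation node `X9TwistedHypothesisIm` (KOLY-MEMO Thm. 3.1 restricted to class X9):

> for every X9 pair `(E, p)` (non-CM, `p ≥ 5` good ordinary, `E[p]` irreducible, `ρ̄_{E,p}` not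
> onto) there is `ζ ∈ ℤ_p` with `ζ^{p-1} = 1`, `ζ² ≠ 1`, and `σ ∈ G_{ℚ(μ_{p^∞})}` with
> `T_pE / (ζ ρ(σ) - 1) T_pE ≅ ℤ_p`

— hypothesis (im) of Burungale–Castella–Skinner 2025 (= Kato 2004 Thm. 13.4 (3)) for the twisted
lattice `T_pE ⊗ χ`, `χ(σ) = ζ`.  It is the positive companion of this lineage's
`not_bcsHypothesisIm_of_classX9` (gen 1: (im) fails for `T_pE` itself).  Nothing is claimed about
`IntegralMainConjectureOnClassX9` / `BSDpOnClassX9`; no count, mark or tier is moved.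

**Proof** (uniform in `p ≥ 5`; no case list of image types).
1. *Mod `p`* (`TwistedIm.exists_det_one_eigenvalue_sq_ne_one`, files `…TwistedImGL2`, `…GL2Five`):
   the image `G = Φ(ρ̄(Γ_ℚ)) ⊊ GL₂(𝔽_p)` contains the split half-Cartan subgroup of inertia at the
   good ordinary prime `p` (`Rank1Residual.exists_halfSplitCartan_le_image_of_goodOrd`, Serre 1972
   §1.11) and fixes no line, so it contains `h` with `det h = 1` and `h v = a v`, `v ≠ 0`,
   `a² ≠ 1` (Serre §2, Props. 14, 15, 17).  Pick `σ₁` with `Φ(ρ̄ σ₁) = h`; `det h = 1 = χ̄_p(σ₁)`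
   (Weil pairing, `exists_frame_galoisRepTorsion_rat`), so `σ₁` fixes `μ_p`; `m = ord h` is
   prime to `p` (`p ∤ #G` by Prop. 15).
2. *Lift* (`TwistedIm.exists_smul_eq_and_galoisRepTate_pow_eq_one`, file `…TwistedImLift`):
   compactness of `Γ_ℚ` gives `σ ∈ G_{ℚ(μ_{p^∞})}` with `ρ(σ)^m = 1` on `T = T_pE` and
   `σ = σ₁` on `E[p]`.
3. *`ℤ_p`-algebra* (file `…TwistedImIdempotent`): `ζ` = the Teichmüller lift of `a⁻¹`
   (`KrizLi2019.exists_unique_pow_eq_one_norm_sub_lt`), `x = ζ ρ(σ)`, `x^M = 1` for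
   `M = m (p-1)`, `e = M⁻¹ ∑_{i<M} x^i`; then `T/(x - 1)T ≅ e T`, and `e T ≅ ℤ_p` because `e ≠ 0`
   (`e t ≡ t (mod pT)` for `t` lifting the eigenvector point `V = e⁻¹(v)`, since
   `x t ≡ ζ a t ≡ t`) and `e ≠ 1` (else `x = 1`, `σ` would act on `E[p]` by a scalar `N` with
   `N a = 1`, forcing `h = a · 1`, `det h = a² ≠ 1`).

References: Burungale–Castella–Skinner, IMRN 2025 = arXiv:2405.00270v2, (im) p. 2
[BurungaleCastellaSkinner2025]; Kato, Astérisque 295 (2004) Thm. 13.4 (3) [Kato2004Asterisque];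
Serre, Invent. Math. 15 (1972) §1.11, §2 [Serre1972]; Serre, *Abelian ℓ-adic representations*
(1968) Ch. I §1.1 [SerreAbelianLadic1968]; Washington §5.1 (Teichmüller) [Washington1997].
-/

noncomputable section

open scoped Classical
open Field Finset Matrix

-- the summit and its single problem are both named `BirchSwinnertonDyer` (registry layout D-0017)
set_option linter.dupNamespace false

namespace Summit.BirchSwinnertonDyer.BirchSwinnertonDyer.Rank1Residual

open WeierstrassCurve Literature.NumberTheory.EllipticCurves Literature.NumberTheory.GaloisRepresentations
  Literature.NumberTheory.GaloisRepresentations.Serre1972 TwistedIm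

/-- **Steps 1–2: the Galois element.**  For an X9 pair `(E, p)` there are `σ ∈ Γ_ℚ` fixing every
`p`-power root of unity, `m ≥ 1` prime to `p` with `ρ_{E,p}(σ)^m = 1` on `T_pE`, and a point
`V ∈ E[p]`, `V ≠ 0`, with `σ V = a V`, `a ∈ 𝔽_pˣ`, `a² ≠ 1`, such that `σ` does not act on `E[p]`
through a scalar: no `N ∈ ℕ` has `N σ Q = Q` for all `Q ∈ E[p]` (mod `p`: the image contains
`h = ρ̄(σ)` with `det h = 1`, eigenvalue `a`, `a² ≠ 1`, by `TwistedIm.exists_det_one_eigenvalue_sq_ne_one`;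
then the lift `TwistedIm.exists_smul_eq_and_galoisRepTate_pow_eq_one`).
[cite: Serre1972, §1.11, §2.2 Prop. 14, §2.4 Prop. 15, §2.7 Prop. 17] -/
theorem exists_galois_element_of_classX9 (W : WeierstrassCurve ℚ) [W.IsElliptic]
    [W.IsGloballyMinimal] (p : ℕ) [Fact p.Prime] (hX9 : ClassX9 W p) :
    ∃ (σ : absoluteGaloisGroup ℚ) (m : ℕ) (a : (ZMod p)ˣ) (V : W.geomPoints),
      m ≠ 0 ∧ p.Coprime m ∧
      (∀ (n : ℕ) (t : AlgebraicClosure ℚ), t ^ p ^ n = 1 → σ • t = t) ∧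
      W.galoisRepTate p σ ^ m = 1 ∧
      a ^ 2 ≠ 1 ∧ V ≠ 0 ∧ p • V = 0 ∧ σ • V = (a : ZMod p).val • V ∧
      ∀ N : ℕ, (∀ Q : W.geomPoints, p • Q = 0 → N • (σ • Q) = Q) → False := by
  obtain ⟨-, h5, hgood, hap, hirr, hns⟩ := hX9
  have hp : p.Prime := Fact.out
  have hp0 : (p : ℚ) ≠ 0 := Nat.cast_ne_zero.mpr hp.ne_zero
  haveI : NeZero (p : ℚ) := ⟨hp0⟩
  haveI : Fact (1 < p) := ⟨hp.one_lt⟩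
  letI : Module (ZMod p) (geomTorsion W p) := AddSubgroup.torsionBy.zmodModule
  -- Step 1: the frame and the image `G`
  obtain ⟨fr, Φ, hfr, -, hdet, -, -⟩ := W.exists_frame_galoisRepTorsion_rat p
  set G : Subgroup (GL (Fin 2) (ZMod p)) := (galoisRepTorsion W p).range.map Φ.toMonoidHom with hG
  have hord : Rank1Residual.GoodOrd W p := ⟨hgood, hap⟩
  obtain ⟨P, hPG⟩ := Rank1Residual.exists_halfSplitCartan_le_image_of_goodOrd W p Φ fr hfr hord
  have hirrG : ∀ (v : Fin 2 → ZMod p) (hv : v ≠ 0), ¬ G ≤ eigenvectorStabilizer v hv :=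
    fun v hv => W.not_le_eigenvectorStabilizer_of_hasIrreducibleModPGaloisRep p Φ fr hfr hirr hv
  have hGtop : G ≠ ⊤ := fun h => hns ((W.map_range_galoisRepTorsion_eq_top_iff p Φ).mp h)
  have hpG : ¬ p ∣ Nat.card G := by
    intro hdvd
    rcases eq_top_or_borel_of_dvd_card G hdvd (W.exists_mem_map_range_det_eq p Φ fr hfr) with
      h | ⟨w, hw, hB⟩
    · exact hGtop h
    · exact hirrG w hw hB
  obtain ⟨h, hhG, hhdet, a, v, hv, ha2, hhv⟩ :=
    exists_det_one_eigenvalue_sq_ne_one h5 G hPG hirrG hGtop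
  obtain ⟨σ₁, hσ₁⟩ := (W.mem_map_range_galoisRepTorsion_iff p Φ).mp hhG
  -- `σ₁` fixes `μ_p`
  have hμ : ∀ t : AlgebraicClosure ℚ, t ^ p = 1 → σ₁ • t = t := by
    intro t ht
    have hχ : modPCyclotomicCharacterZMod ℚ p σ₁ = 1 := by rw [← hdet σ₁, hσ₁, hhdet]
    rw [modPCyclotomicCharacterZMod_spec ℚ p σ₁ t ht, hχ, Units.val_one, ZMod.val_one, pow_one]
  -- `m = ord h`, prime to `p`; `σ₁ ^ m` is trivial on `E[p]`
  set m : ℕ := orderOf h with hm_def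
  have hm0 : m ≠ 0 := (orderOf_pos h).ne'
  have hmG : m ∣ Nat.card G := by
    rw [hm_def, ← Subgroup.orderOf_mk h hhG]
    exact orderOf_dvd_natCard _
  have hpm : p.Coprime m := (Nat.Prime.coprime_iff_not_dvd hp).mpr fun h => hpG (h.trans hmG)
  have hρpow : ∀ (k : ℕ), Φ (galoisRepTorsion W p (σ₁ ^ k)) = h ^ k := fun k => by
    rw [map_pow, map_pow, hσ₁]
  have hE : ∀ Q : W.geomPoints, p • Q = 0 → σ₁ ^ m • Q = Q := by
    intro Q hQ
    have hQ' : Q ∈ geomTorsion W p := AddSubgroup.torsionBy.nsmul_iff.mpr hQ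
    have h1 : galoisRepTorsion W p (σ₁ ^ m) = galoisRepTorsion W p 1 :=
      Φ.injective (by rw [hρpow, map_one, hm_def, pow_orderOf_eq_one, map_one])
    calc σ₁ ^ m • Q
        = ((Multiplicative.toAdd (galoisRepTorsion W p (σ₁ ^ m))) ⟨Q, hQ'⟩ : W.geomPoints) := rfl
      _ = ((Multiplicative.toAdd (galoisRepTorsion W p 1)) ⟨Q, hQ'⟩ : W.geomPoints) := by rw [h1]
      _ = Q := by
        change (1 : absoluteGaloisGroup ℚ) • Q = Q
        exact one_smul _ _
  -- Step 2: the lift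
  obtain ⟨σ, hσμ, hσm, hσ1⟩ := exists_smul_eq_and_galoisRepTate_pow_eq_one W p σ₁ hm0 hpm hμ hE
  have hρσ : galoisRepTorsion W p σ = galoisRepTorsion W p σ₁ := by
    apply Multiplicative.toAdd.injective
    refine AddEquiv.ext fun Q => Subtype.ext ?_
    exact hσ1 Q (AddSubgroup.torsionBy.nsmul_iff.mp Q.2)
  -- the eigenvector point `V` and the action of `σ` on it
  set V₀ : geomTorsion W p := fr.symm v with hV₀def
  have hV₀ : fr V₀ = v := fr.apply_symm_apply v
  have hV₀ne : (V₀ : W.geomPoints) ≠ 0 := by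
    intro h0
    apply hv
    rw [← hV₀, show V₀ = 0 from Subtype.ext h0, map_zero]
  have hσV : σ • (V₀ : W.geomPoints) = (a : ZMod p).val • (V₀ : W.geomPoints) := by
    have h1 : fr ((Multiplicative.toAdd (galoisRepTorsion W p σ)) V₀) =
        fr ((a : ZMod p).val • V₀) := by
      rw [hfr, hρσ, hσ₁, hV₀, hhv, map_nsmul, hV₀, ← Nat.cast_smul_eq_nsmul (ZMod p),
        ZMod.natCast_zmod_val]
    have h2 := congrArg Subtype.val (fr.injective h1)
    rw [galoisRepTorsion_apply, AddSubgroup.torsionBy.coe_smul, AddSubmonoidClass.coe_nsmul] at h2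
    exact h2
  have hpV : p • (V₀ : W.geomPoints) = 0 := AddSubgroup.torsionBy.nsmul_iff.mp V₀.2
  refine ⟨σ, m, a, V₀, hm0, hpm, hσμ, hσm, ha2, hV₀ne, hpV, hσV, fun N hfix => ?_⟩
  -- non-scalarity: in the frame, `N • (h w) = w` for all `w`
  have hframe : ∀ w : Fin 2 → ZMod p,
      (N : ZMod p) • ((h : Matrix (Fin 2) (Fin 2) (ZMod p)) *ᵥ w) = w := by
    intro w
    have h1 := hfix (fr.symm w) (AddSubgroup.torsionBy.nsmul_iff.mp (fr.symm w).2)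
    have h2 : N • ((Multiplicative.toAdd (galoisRepTorsion W p σ)) (fr.symm w)) = fr.symm w := by
      apply Subtype.ext
      rw [AddSubmonoidClass.coe_nsmul, galoisRepTorsion_apply, AddSubgroup.torsionBy.coe_smul]
      exact h1
    have h3 := congrArg fr h2
    rw [map_nsmul, hfr, hρσ, hσ₁, fr.apply_symm_apply, ← Nat.cast_smul_eq_nsmul (ZMod p)] at h3
    exact h3
  -- `N a = 1`, so `h w = a w` for all `w`, `h = a • 1`, `det h = a²`
  have hNa : (N : ZMod p) * (a : ZMod p) = 1 := by
    have h1 := hframe v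
    rw [hhv, smul_smul] at h1
    have h2 : ((N : ZMod p) * (a : ZMod p) - 1) • v = 0 := by rw [sub_smul, one_smul, h1, sub_self]
    rcases smul_eq_zero.mp h2 with h3 | h3
    · exact sub_eq_zero.mp h3
    · exact absurd h3 hv
  have hscalar : ∀ w : Fin 2 → ZMod p,
      (h : Matrix (Fin 2) (Fin 2) (ZMod p)) *ᵥ w = (a : ZMod p) • w := by
    intro w
    calc (h : Matrix (Fin 2) (Fin 2) (ZMod p)) *ᵥ w
        = ((a : ZMod p) * (N : ZMod p)) • ((h : Matrix (Fin 2) (Fin 2) (ZMod p)) *ᵥ w) := by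
          rw [mul_comm, hNa, one_smul]
      _ = (a : ZMod p) • w := by rw [← smul_smul, hframe]
  have hmat : (h : Matrix (Fin 2) (Fin 2) (ZMod p)) =
      (a : ZMod p) • (1 : Matrix (Fin 2) (Fin 2) (ZMod p)) := by
    ext i j
    have := congrFun (hscalar (Pi.single j 1)) i
    rw [Matrix.mulVec_single_one, Matrix.col_apply] at this
    rw [this]
    simp only [Pi.smul_apply, Matrix.smul_apply, Matrix.one_apply, Pi.single_apply]
  apply ha2
  have hd : Matrix.det (h : Matrix (Fin 2) (Fin 2) (ZMod p)) = (a : ZMod p) ^ 2 := by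
    rw [hmat, Matrix.det_smul, Matrix.det_one, mul_one, Fintype.card_fin]
  rw [← Matrix.GeneralLinearGroup.val_det_apply, hhdet, Units.val_one] at hd
  exact Units.ext (by rw [Units.val_pow_eq_pow_val, ← hd, Units.val_one])

/-- **Class X9: the twisted hypothesis (im), for one pair.**  For an X9 pair `(E, p)` there are
`ζ ∈ ℤ_p`, `ζ^{p-1} = 1`, `ζ² ≠ 1`, and `σ ∈ Γ_ℚ` fixing every `p`-power root of unity with
`T_pE/(ζ ρ_{E,p}(σ) - 1)T_pE ≃ ℤ_p`.  See the module docstring for the proof.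
[cite: BurungaleCastellaSkinner2025, hypothesis (im) (p. 2)] [cite: Serre1972, §1.11, §2.2 Prop. 14, §2.4 Prop. 15, §2.7 Prop. 17] -/
theorem exists_twistedHypothesisIm_of_classX9 (W : WeierstrassCurve ℚ) [W.IsElliptic]
    [W.IsGloballyMinimal] (p : ℕ) [Fact p.Prime] (hX9 : ClassX9 W p) :
    ∃ ζ : ℤ_[p], ζ ^ (p - 1) = 1 ∧ ζ ^ 2 ≠ 1 ∧ TwistedHypothesisIm W p ζ := by
  have h5 : 5 ≤ p := hX9.2.1
  obtain ⟨σ, m, a, V, hm0, hpm, hσμ, hσm, ha2, hVne, hpV, hσV, hnonscalar⟩ :=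
    exists_galois_element_of_classX9 W p hX9
  have hp : p.Prime := Fact.out
  have hp0 : (p : ℚ) ≠ 0 := Nat.cast_ne_zero.mpr hp.ne_zero
  -- Step 3: `ζ`, the Teichmüller lift of `a⁻¹`
  set n : ℕ := ((a⁻¹ : (ZMod p)ˣ) : ZMod p).val with hn
  have hnp : ¬ (p : ℤ) ∣ (n : ℤ) := by
    intro hdvd
    have hc := ZMod.val_coe_unit_coprime (a⁻¹)
    have hdvd' : p ∣ n := by exact_mod_cast hdvd
    have : p ∣ Nat.gcd n p := Nat.dvd_gcd hdvd' (dvd_refl p)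
    rw [hc] at this
    exact hp.one_lt.ne' (Nat.dvd_one.mp this)
  obtain ⟨ζ, hζ1, hζn, -⟩ := KrizLi2019.exists_unique_pow_eq_one_norm_sub_lt (p := p) (n : ℤ) hnp
  have hζmod : PadicInt.toZMod ζ = ((a⁻¹ : (ZMod p)ˣ) : ZMod p) := by
    have hmem : ζ - (n : ℤ_[p]) ∈ RingHom.ker (PadicInt.toZMod (p := p)) := by
      rw [PadicInt.ker_toZMod, IsLocalRing.mem_maximalIdeal, PadicInt.mem_nonunits]
      exact_mod_cast hζn
    rw [RingHom.mem_ker, map_sub, sub_eq_zero, map_natCast] at hmem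
    rw [hmem, hn, ZMod.natCast_zmod_val]
  have hζa : PadicInt.toZMod ζ * (a : ZMod p) = 1 := by
    rw [hζmod, ← Units.val_mul, inv_mul_cancel, Units.val_one]
  have hζ2 : ζ ^ 2 ≠ 1 := by
    intro h2
    apply ha2
    have h3 := congrArg (PadicInt.toZMod (p := p)) h2
    rw [map_pow, map_one, hζmod, ← Units.val_pow_eq_pow_val, inv_pow] at h3
    exact Units.ext (by
      rw [Units.val_one, ← _root_.inv_inj, ← Units.val_inv_eq_inv_val, h3, inv_one])
  refine ⟨ζ, hζ1, hζ2, σ, hσμ, ?_⟩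
  -- Step 4: the `ℤ_p`-module `T`, `x = ζ ρ(σ)`, `x ^ M = 1`, `c M = 1`
  haveI : Module.Free ℤ_[p] (W.tateModule p) := module_free_tateModule_holds W p
  haveI : Module.Finite ℤ_[p] (W.tateModule p) := module_finite_tateModule_holds W p
  have hT2 : Module.finrank ℤ_[p] (W.tateModule p) = 2 := finrank_tateModule_eq_two_holds W p hp0
  set T := W.tateModule p
  set s : Module.End ℤ_[p] T := W.galoisRepTate p σ with hs
  set x : Module.End ℤ_[p] T := ζ • s with hx_def
  have hx_apply : ∀ t : T, x t = ζ • (σ • t) := fun t => rfl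
  set M : ℕ := m * (p - 1) with hM
  have hsM : s ^ M = 1 := by rw [hM, pow_mul, hσm, one_pow]
  have hζM : ζ ^ M = 1 := by rw [hM, mul_comm, pow_mul, hζ1, one_pow]
  have hxM : x ^ M = 1 := by rw [hx_def, smul_pow, hsM, hζM, one_smul]
  have hMu : IsUnit ((M : ℕ) : ℤ_[p]) := by
    rw [PadicInt.isUnit_iff]
    apply le_antisymm (PadicInt.norm_le_one _)
    by_contra hlt
    have hdvd : (p : ℤ) ∣ (M : ℤ) :=
      (PadicInt.norm_int_lt_one_iff_dvd (M : ℤ)).mp (by simpa using not_le.mp hlt)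
    have hdvd' : p ∣ m * (p - 1) := by rw [← hM]; exact_mod_cast hdvd
    rcases (Nat.Prime.dvd_mul hp).mp hdvd' with h | h
    · exact (Nat.Prime.coprime_iff_not_dvd hp).mp hpm h
    · have : p ≤ p - 1 := Nat.le_of_dvd (by omega) h
      omega
  obtain ⟨c, hc⟩ := hMu.exists_left_inv
  -- `T/(x - 1)T ≃ range e`
  obtain ⟨Ψ₁⟩ := quotient_range_sub_one_equiv_range_avg x hxM hc
  have hidem := isIdempotentElem_avg x hxM hc
  set eavg : Module.End ℤ_[p] T := c • ∑ i ∈ range M, x ^ i with heavg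
  -- Step 5: `e ≠ 0` and `e ≠ 1`, by reduction mod `p`
  -- the eigenvector point `V` and its action
  -- a lift `t ∈ T` of `V`
  have hVmem : V ∈ geomTorsion W (p ^ 1 : ℕ) := by
    rw [pow_one]; exact AddSubgroup.torsionBy.nsmul_iff.mpr hpV
  obtain ⟨t, ht⟩ := W.proj_surjective_of_isAlgClosed_holds p 1 hVmem
  -- the submodule `S = ker (T → E[p]) ⊇ pT`
  let S : Submodule ℤ_[p] T :=
    { carrier := {y | TateModule.proj p 1 y = 0}
      add_mem' := fun {y z} hy hz => by
        simp only [Set.mem_setOf_eq] at hy hz ⊢; rw [map_add, hy, hz, add_zero]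
      zero_mem' := by simp
      smul_mem' := fun r y hy => by
        simp only [Set.mem_setOf_eq] at hy ⊢; rw [TateModule.proj_smul, hy, smul_zero] }
  have hS_mem : ∀ y : T, y ∈ S ↔ TateModule.proj p 1 y = 0 := fun y => Iff.rfl
  have hS_x : ∀ y ∈ S, x y ∈ S := by
    intro y hy
    rw [hS_mem] at hy ⊢
    rw [hx_apply, TateModule.proj_smul, TateModule.proj_smul_of_distribMulAction, hy, smul_zero,
      smul_zero]
  have hS_p : ∀ y : T, (p : ℤ_[p]) • y ∈ S := by
    intro y
    rw [hS_mem, Nat.cast_smul_eq_nsmul, map_nsmul]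
    have := TateModule.pow_smul_proj 1 y
    rwa [pow_one] at this
  -- `x t - t ∈ S`
  have hxt : x t - t ∈ S := by
    have hdec : x t - t =
        ζ • (σ • t - (((a : ZMod p).val : ℕ) : ℤ_[p]) • t) +
          (ζ * (((a : ZMod p).val : ℕ) : ℤ_[p]) - 1) • t := by
      rw [hx_apply, smul_sub, sub_smul, one_smul, smul_smul]; abel
    rw [hdec]
    refine S.add_mem (S.smul_mem ζ ?_) ?_
    · rw [hS_mem, map_sub, TateModule.proj_smul_of_distribMulAction, Nat.cast_smul_eq_nsmul,
        map_nsmul, ht, hσV, sub_self]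
    · have hker : ζ * (((a : ZMod p).val : ℕ) : ℤ_[p]) - 1 ∈
          RingHom.ker (PadicInt.toZMod (p := p)) := by
        rw [RingHom.mem_ker, map_sub, map_mul, map_natCast, map_one, ZMod.natCast_zmod_val, hζa,
          sub_self]
      rw [PadicInt.ker_toZMod, PadicInt.maximalIdeal_eq_span_p, Ideal.mem_span_singleton] at hker
      obtain ⟨y, hy⟩ := hker
      rw [hy, mul_smul]
      exact hS_p _
  have he0 : eavg ≠ 0 := by
    intro h0
    have hmem : eavg t - t ∈ S := avg_apply_sub_mem x hc hS_x hxt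
    rw [h0, LinearMap.zero_apply, zero_sub, hS_mem, map_neg, ht, neg_eq_zero] at hmem
    exact hVne hmem
  have he1 : eavg ≠ 1 := by
    intro h1
    -- then `x = 1` on `T`
    have hx1 : x = 1 := by
      have := sub_one_mul_avg x hxM (c := c)
      rw [← heavg, h1, mul_one, sub_eq_zero] at this
      exact this
    -- so `N • (σ • Q) = Q` on `E[p]`, `N = (ζ mod p)` as a natural number: excluded
    refine hnonscalar (PadicInt.toZModPow 1 ζ).val fun Q hQ => ?_
    have hQmem : Q ∈ geomTorsion W (p ^ 1 : ℕ) := by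
      rw [pow_one]; exact AddSubgroup.torsionBy.nsmul_iff.mpr hQ
    obtain ⟨y, hy⟩ := W.proj_surjective_of_isAlgClosed_holds p 1 hQmem
    have h2 : x y = y := by rw [hx1, Module.End.one_apply]
    have h3 := congrArg (TateModule.proj p 1) h2
    rwa [hx_apply, TateModule.proj_smul, TateModule.proj_smul_of_distribMulAction, hy] at h3
  -- Step 6: assemble
  obtain ⟨Ψ₂⟩ := nonempty_range_equiv_of_isIdempotentElem hT2 hidem he0 he1
  exact ⟨Ψ₁.trans Ψ₂⟩

/-- **KERNEL PROOF of the cell's obligation node `X9TwistedHypothesisIm`** (KOLY-MEMO Thm. 3.1 on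
class X9): for every X9 pair `(E, p)` the twisted hypothesis (im) holds at a root of unity
`ζ ∈ μ_{p-1}(ℤ_p)` with `ζ² ≠ 1`.  Uniform in `p ≥ 5` (no `{5Ns, 5S4, 7Ns}` case list); contrast
`not_twistedHypothesisIm_one_of_classX9` (`ζ = 1` fails). [cite: BurungaleCastellaSkinner2025, hypothesis (im) (p. 2), Rem. 1.1.3 (iii)] [cite: Kato2004Asterisque, Thm. 13.4 (3)] -/
theorem X9TwistedHypothesisIm_holds : X9TwistedHypothesisIm :=
  fun W _ _ p _ hX9 => exists_twistedHypothesisIm_of_classX9 W p hX9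

end Summit.BirchSwinnertonDyer.BirchSwinnertonDyer.Rank1Residual
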